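import Mathlib.Analysis.Analytic.Order
import Mathlib.Order.LiminfLimsup
import Literature.NumberTheory.LFunctions.RiemannXi
import HarnessLib
import HarnessLib.Audit

/-!
# Zeros of the derivatives `ξ^{(m)}` on the critical line (Conrey 1983)

Statement-level named facts (D-0014, `def … : Prop`, cited) on the horizontal distribution of the
zeros of the derivatives of Riemann's `ξ`-function
`ξ(s) = riemannXi s = ½ s (s − 1) π^{−s/2} Γ(s/2) ζ(s)`, after
J. B. Conrey, *Zeros of derivatives of Riemann's ξ-function on the critical line*,
J. Number Theory 16 (1983) 49–74 (`Conrey1983`): the multiplicity-counted counting functions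
`N^{(m)}(T)`, `N^{(m)}₀(T)` of the zeros of `ξ^{(m)}` in `0 < Im s ≤ T` (all / on `Re s = 1/2`),
the proportion `κ'_m = liminf N^{(m)}₀(T)/N^{(m)}(T)`, Conrey's Corollary (p. 50)
`α₁ > 0.8137` (hence `κ'_1 ≥ 0.8137`), and the heredity statement quoted on p. 49
("the Riemann hypothesis implies that all of the zeros of `ξ^{(m)}(s)` have real part `½` for any
`m`"), stated for `m = 1`.

Design choices. Multiplicities are `analyticOrderAt (iteratedDeriv m riemannXi) s` (an `ℕ∞`, read
in `ℕ` by `toNat`; `ξ^{(m)}` is entire and not identically zero, so the order is finite at every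
point and the zero set in a bounded box is finite — the `finsum` is then a genuine finite sum; for
`T` below the first ordinate both counts are `0` and the ratio is `0` by the division convention, which
does not affect the `liminf` at `+∞`). Conrey's `α_m` is a SHORT-INTERVAL lower density
(`liminf [N^{(m)}₀(T+U) − N^{(m)}₀(T)] / (UL/2π)`, `U = T/L¹⁰`, p. 49), which implies the global
proportion bound stated here by summation over blocks together with his Lemma 2 (p. 52:
`N^{(m)}(T) = (T/2π) log(T/2π) − T/2π + O_m(log T)`); Levinson's method counts the zeros on the line
with multiplicity, matching `xiDerivCriticalZeroCount`. What is NOT here: the simple-zero proportions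
of part II (J. Number Theory 17 (1983) 71–75, Cor. 1: `β₁ > 0.7869`), the `m ≥ 2` table
(`α₂ > 0.9584`, `α₃ > 0.9873`, `α₄ > 0.9948`, `α₅ > 0.9970`) and `α_m = 1 + O(m⁻²)`, and any proof.

Proved elsewhere in this tree (cross-references as of 2026-08-27, all RH-free unless marked):
`riemannHypothesis_imp_xiDeriv_zeros_on_line_holds` (the heredity statement, DISCHARGED;
`XiDerivativeZerosProofs.lean`); Conrey's Lemma 2 for `m = 1` (every zero of `ξ′` has `0 < Re s < 1`:
`Conrey1983_lemma2_xiDeriv_strip`), finiteness of `xiDerivZeroBox 1 T` (`xiDerivZeroBox_one_finite`),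
monotonicity of `xiDerivZeroCount 1` / `xiDerivCriticalZeroCount 1`, `N^{(1)}₀ ≤ N^{(1)}`,
`N^{(1)}₀(T), N^{(1)}(T) → ∞` (Hardy + Rolle: `tendsto_xiDerivCriticalZeroCount_one_atTop`,
`tendsto_xiDerivZeroCount_one_atTop`), the `liminf` dictionary for `xiDerivCriticalLineProportion 1`
(`le_xiDerivCriticalLineProportion_one_of_eventually_le`, `…_of_dyadic`) and RH ⇒ `κ'_1 = 1` ⇒
`conrey1983_xiDeriv_one` (RH-CONDITIONAL) — `XiDerivativeZerosCounting.lean`; Alpöge–Furman 2026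
Remark 7.1 (claim) ⇒ `conrey1983_xiDeriv_one` — `CriticalLineTwoThirdsXiDeriv.lean`; Conrey's Lemma 2
for `m = 1`, counting part — `N^{(1)}(T) − N(T) = O(log T)`
(`exists_abs_xiDerivZeroCount_sub_zetaZeroCount_le_log`) and the printed
`N^{(1)}(T) = (T/2π) log(T/2π) − T/2π + O(log T)` (`xiDerivZeroCount_one_riemann_von_mangoldt`), by the
argument principle for `ξ′` and Backlund's lemma — `XiDerivativeZeroCountingFunction.lean`; the Rolle
transfer `N₀ˢ(T) ≤ N^{(1)}₀(T) + 1` from the (simple) critical zeros of `ζ` and, with [AF26] Theorem A (a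
kernel theorem of the tree), `N^{(1)}₀(T) ≥ (2/3 − ε) N(T)` eventually —
`XiDerivativeCriticalZerosRolle.lean`; hence the UNCONDITIONAL lower bounds `2/3 ≤ κ'_1`
(`two_thirds_le_xiDerivCriticalLineProportion_one`, `XiDerivativeCriticalLineProportionTwoThirds.lean`) and
`2 − c_MT⁻¹ = 0.6725… ≤ κ'_1` (`two_sub_montgomeryTaylorInvConstant_le_xiDerivCriticalLineProportion_one`,
`CriticalLineMontgomeryTaylorCumulative.lean`). GENERAL `m` (2026-08-27): Conrey's Lemma 2, FIRST
STATEMENT, for every `m` — every zero of `ξ^{(m)}` has `0 < Re s < 1` (`Conrey1983_lemma2_strip`), with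
Conrey's displayed inequality `Re ξ^{(m+1)}/ξ^{(m)}(s) > 0` for `Re s ≥ 1`
(`re_iteratedDeriv_succ_div_pos_of_one_le_re`) and the heredity statement for every `m`
(RH ⇒ all zeros of every `ξ^{(m)}` on `Re s = ½`: `riemannHypothesis_imp_iteratedDeriv_riemannXi_zeros_on_line`),
by the tree's Hadamard-free Jensen circle theorem for `Ξ` — `XiHigherDerivativesCriticalStrip.lean`;
finiteness of `xiDerivZeroBox m T`, `N^{(m)}₀ ≤ N^{(m)}`, monotonicity, the `m`-fold Rolle transfer
`N₀ˢ(T) ≤ N^{(m)}₀(T) + m`, hence `N^{(m)}₀(T) ≥ (2/3 − ε) N(T)` eventually and `N^{(m)}₀, N^{(m)} → ∞`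
for every `m`, the `liminf` dictionary `le_xiDerivCriticalLineProportion_of_eventually_le`, and RH ⇒
`κ'_m = 1` for every `m` — `XiHigherDerivativesCriticalZeros.lean`; horizontal monotonicity of
`|ξ^{(m)}(σ + it)|` (Sondow–Dumitrescu for every derivative: unconditional on `σ ≥ 1`; all zeros of
`ξ^{(m)}` on the line ⟺ strictly increasing on `σ ≥ ½`; heredity `m ≤ m'`) —
`XiHigherDerivativesModulusMonotone.lean` (also: RH ⟺ all zeros of every `ξ^{(m)}` on the line ⟺
monotone modulus for every `m`); `0 < κ'_m` for every `m` by a Jensen count `N^{(m)}(T) ≪ T log T` —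
`XiHigherDerivativesCriticalLineProportionPos.lean`; Conrey's Lemma 2, COUNTING PART, for `m = 2` with
explicit constants (`|N^{(2)}(T) − N(T)| ≤ 150 + 72 log(T+7)`, the quantitative Jensen-circle sign lemma
`XiDeriv2Arg.im_mul_im_logDeriv_le`, `Re ξ″/ξ′(2+iT) ≥ (3/4)/(T² + 9/4)`) —
`XiSecondDerivativeZeroCountingFunction.lean`; and FOR EVERY `m` — `N^{(m)}(T) − N(T) = O_m(log T)`
(`exists_abs_xiDerivZeroCount_sub_zetaZeroCount_le_log_all`), the printed
`N^{(m)}(T) = (T/2π) log(T/2π) − T/2π + O_m(log T)` (`xiDerivZeroCount_riemann_von_mangoldt`),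
`N^{(m)}/N → 1`, by Backlund's argument run uniformly in `m` (`h_m = D^m ζ`, `D φ = φ′ + G φ`) — whence
the UNCONDITIONAL lower bounds `2/3 ≤ κ'_m` (`two_thirds_le_xiDerivCriticalLineProportion`) and
`0.6725 ≤ 2 − c_MT⁻¹ ≤ κ'_m` (`xiDerivCriticalLineProportion_ge_06725`) for every `m` —
`XiHigherDerivativesZeroCountingFunction.lean` (also local density / multiplicity `O(log T)`); SIMPLE
critical zeros: for every `m ≥ 1` at least `(2κ − 1 − ε) N(T)` zeros of `ξ^{(m)}` up to `T` are simple and on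
the line for any cumulative simple-critical proportion `κ` of `ζ`, so `(0.345 − ε) N(T)` (weak
unconditional form of Conrey 1983 II Cor. 1, `β₁ > 0.7869` NOT proved) —
`XiHigherDerivativesSimpleCriticalZeros.lean`; Laguerre's separation theorem (Boas Thm 2.8.1) and, under
RH, the Laguerre inequalities for every `Ξ^{(m)}`, simplicity of the new zeros, interlacing, and
RH ⟺ `Ξ ∈ 𝓛𝓟` — `XiLaguerreSeparationRH.lean`; zeros of `ξ^{(m)}` off the line are shadowed by zeros of
`ζ` off the line, so (kernel certificate RH up to height `101`) every zero of `ξ^{(m)}` with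
`|Im s| ≤ 101 − m/2` is on the line — `XiHigherDerivativesOffLineZeros.lean`; Rolle WITH multiplicity
`N₀^{(m)}(T) ≤ N₀^{(m+1)}(T) + 1`, `N^{(0)}(T) = N(T)`, and under RH the exact count
`|N^{(m+1)}(T) − N^{(m)}(T)| ≤ 1`, `|N^{(m)}(T) − N(T)| ≤ m` for every `T` —
`XiHigherDerivativesCriticalCountStep.lean`. NOT proved in the tree: the fact `conrey1983_xiDeriv_one`
itself (`0.8137`), Conrey's table `κ'_m ≥ .9584, .9873, .9962, .99874` and Conrey II's `β_m` (Levinson's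
method for `ξ^{(m)}`).
-/

noncomputable section

open Filter

namespace Literature.NumberTheory.LFunctions

/-- The zeros of `ξ^{(m)} = iteratedDeriv m riemannXi` with `0 < Im s ≤ T` (as a set; all of them lie
in the open critical strip `0 < Re s < 1`, Conrey 1983 Lemma 2). [cite: Conrey1983, §1 (p. 49) and Lemma 2 (p. 52)] -/
def xiDerivZeroBox (m : ℕ) (T : ℝ) : Set ℂ :=
  {s | iteratedDeriv m riemannXi s = 0 ∧ 0 < s.im ∧ s.im ≤ T}

/-- `N^{(m)}(T)`: the number of zeros of `ξ^{(m)}` with `0 < Im s ≤ T`, counted with multiplicity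
(`analyticOrderAt`, read in `ℕ`). Conrey 1983, Lemma 2: `N^{(m)}(T) = (T/2π) log (T/2π) − T/2π + O_m(log T)`.
[cite: Conrey1983, Lemma 2 (p. 52)] -/
def xiDerivZeroCount (m : ℕ) (T : ℝ) : ℕ :=
  ∑ᶠ s ∈ xiDerivZeroBox m T, (analyticOrderAt (iteratedDeriv m riemannXi) s).toNat

/-- `N^{(m)}₀(T)`: the number of zeros of `ξ^{(m)}` ON the critical line `Re s = 1/2` with
`0 < Im s ≤ T`, counted with multiplicity. [cite: Conrey1983, §1 (p. 49)] -/
def xiDerivCriticalZeroCount (m : ℕ) (T : ℝ) : ℕ :=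
  ∑ᶠ s ∈ {s ∈ xiDerivZeroBox m T | s.re = 1 / 2}, (analyticOrderAt (iteratedDeriv m riemannXi) s).toNat

/-- The critical-line proportion for `ξ^{(m)}`: `κ'_m = liminf_{T → ∞} N^{(m)}₀(T) / N^{(m)}(T)`
(ratio in `[0, 1]`, so the real `liminf` is junk-free). [cite: Conrey1983, §1 (p. 49)] -/
def xiDerivCriticalLineProportion (m : ℕ) : ℝ :=
  liminf (fun T : ℝ => (xiDerivCriticalZeroCount m T : ℝ) / xiDerivZeroCount m T) atTop

/-- **Conrey 1983, Corollary (p. 50), `m = 1`.** More than `81.37 %` of the zeros of `ξ′` are on the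
critical line: with `α₁ = liminf_T [N′₀(T+U) − N′₀(T)]/(UL/2π)`, `U = T/L¹⁰`, `L = log(T/2π)`, Conrey
proves `α₁ > 0.8137` (Levinson's method with the mollified `ξ′`; Theorem p. 49–50 with `R`, `φ`
optimised in §7, p. 72: `0.81378`), which by summation over blocks and Lemma 2 gives the global
multiplicity-counted proportion bound below. (For comparison: for `ξ` itself the records are
`κ ≥ 0.4088`, `conrey_bound`, and `κ > 5/12`, `przz_bound`.) [cite: Conrey1983, Corollary (p. 50) and §7 (p. 72)] -/
def conrey1983_xiDeriv_one : Prop :=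
  (0.8137 : ℝ) ≤ xiDerivCriticalLineProportion 1

/-- **Heredity of RH to `ξ′` (Conrey 1983, p. 49; Levinson–Montgomery 1974).** "It can be shown that the
Riemann hypothesis implies that all of the zeros of `ξ^{(m)}(s)` … have real part `½` for any `m`":
the case `m = 1`, stated with Mathlib's `RiemannHypothesis` and `deriv riemannXi`. (Proof in print:
under RH, `Re (ξ′/ξ)(s) = Σ_ρ Re (s − ρ)⁻¹ > 0` for `Re s > 1/2` by the Hadamard product, and the
functional equation `ξ′(1 − s) = −ξ′(s)`.) [cite: Conrey1983, §1 (p. 49)] -/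
def riemannHypothesis_imp_xiDeriv_zeros_on_line : Prop :=
  RiemannHypothesis → ∀ s : ℂ, deriv riemannXi s = 0 → s.re = 1 / 2

end Literature.NumberTheory.LFunctions

end
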